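import Summits.Ventures.HSemireg.WedgeHankelBoxKernelFlat
import Summits.Ventures.HSemireg.WedgeHankelDivisorMirror

/-!
# Venture HSemireg — BOXES × DIVISORS: the uniform divisor kernel law `Kr(univ, w_n(Σ_i expMul λ_i q_i), k) = ⋂_i (SI_k ⊔ Φs λ_i xRich(k, P_i))` for EVERY
# `D ≤ n + 1 − k`, and the kernel of a Hankel BOX whose factors are node / divisor classes, NAMED (gen 13's flat Künneth law instantiated)

HONEST FRAMING. Part of the Lean index of the computation cell `pub-hsemireg` (seat p10 gen 18, Sunday typer «UNIFORM-IN-n»).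
Finite-dimensional EXTERIOR ALGEBRA over a field ONLY: no variety, no cohomology theory, no sheaf, no Ext group, no semiregularity map;
nothing here says that HC / HC_CM / HC_AV holds; no Literature fact is declared or used.  Custodian versions as in `WedgeHankelSiegelIdeal` (1/3), `WedgeKunnethKernelFlat`,
`WedgeHankelFrameChange`; the dictionary (`v_i = exp(λ_iΘ_i)·p_i(Θ_i)` in block `i` of a box `v_0 ⊠ ⋯ ⊠ v_{n−1}`) is QUOTED, never asserted.

WHAT IS IN THE TREE.  C8 `Kr_hankelBox_eq_iSup_T` / `T_hankelBox_eq_map`: the kernel of EVERY Hankel box in every degree is `⨆_i ⨆_{b ≤ k} emb_i(Kr(univ, w_{m_i}(q_i), b)) ∧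
Hom(other blocks, k − b)`; E5 `Kr_w_expMul_of_order` (node `λ` of order `P+1`: `SI_k ⊔ Φs λ xRich(k,P)`, `k + P ≤ n`); F2b `Kr_w_expMul_sum` (divisor class, `D ≤ k+1` and
`D ≤ n+1−k`: `⋂_i` node kernels), F2c `Kr_w_expMul_sum_eq_siegelIdeal` (`k+1 ≤ D ≤ n+1−k`: `SI_k`), G4 `iInf_sup_map_Φs_xRich_eq_siegelIdeal` (`⋂_i` node names `= SI_k` once `D ≥ k+1`).
Gen 16 CLOSE §4 (d) / READ-NOTE-g17 §E: «boxes × divisors (instantiation of C1 with the node-kernel names)» OPEN.  THIS FILE: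
* §140 (namespace `…Wedge.KernelDuality` continued) **`Kr_w_expMul_sum_eq_iInf_of_le`: for distinct nodes, exact orders, `k + P_i ≤ n` and `D ≤ n + 1 − k` (NO comparison of `D`
  with `k + 1`): `Kr(univ, w_n(Σ_i expMul λ_i q_i), k) = ⋂_i (SI_k ⊔ Φs λ_i xRich(k, P_i))`** — F2b below `k+1`, F2c + G4 above: ONE name on the whole range `D ≤ n + 1 − k`
  (and it fails beyond, G9 `Kr_w_expMul_sum_eq_iInf_iff`); `Kr_w_expMul_sum_eq_iInf_Kr_of_le` (the same with the node classes' kernels).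
* §141 (namespace `…Wedge.HankelBoxKernel` continued) **`Kr_hankelBox_nodes`**: a box of NODE classes (`v_i` of exact order `P_i` at `λ_i`, `k + P_i ≤ m_i`):
  `Kr(univ, F, k) = ⨆_i ⨆_{b ≤ k} emb_i(SI_b ⊔ Φs λ_i xRich(b, P_i)) ∧ Hom(other blocks, k − b)`; **`Kr_hankelBox_divisors`**: a box of DIVISOR classes (block `i`: distinct nodes
  `λ_ij`, exact orders `P_ij`, `k + P_ij ≤ m_i`, total order `D_i ≤ m_i + 1 − k`): the same with `⋂_j (SI_b ⊔ Φs λ_ij xRich(b, P_ij))` in block `i` — the kernel of a box of divisor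
  classes is generated by the NODE kernels of the factors, block by block and degree by degree.
NOT typed here: node(s) at `∞` inside a factor (E4/F3b names plug in verbatim); degrees with `D_i > m_i + 1 − k` in some block (no uniform name, G9/H3); anything Ext-side.
Class side only; new names only.
-/

open Module

namespace Summit.Ventures.HSemireg.Wedge.KernelDuality

open Summit.Ventures.HSemireg.Wedge Summit.Ventures.HSemireg.Wedge.Kunneth Summit.Ventures.HSemireg.Wedge.Hankel
  Summit.Ventures.HSemireg.Wedge.HankelSiegel Summit.Ventures.HSemireg.Wedge.HankelSiegelIdeal Summit.Ventures.HSemireg.Wedge.KunnethKernel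
  Summit.Ventures.HSemireg.Wedge.HankelFrameChange

variable (K : Type*) [Field K] {n : ℕ}

/-! ## §140. The uniform divisor kernel law on `D ≤ n + 1 − k` -/

/-- **THE UNIFORM DIVISOR KERNEL LAW: `Kr(univ, w_n(Σ_i expMul λ_i q_i), k) = ⋂_i (SI_k ⊔ Φs λ_i (xRich(k, P_i)))` for distinct nodes, exact orders `P_i` (`k + P_i ≤ n`, `r > 0`)
and total order `D ≤ n + 1 − k`** — whatever the comparison of `D` with `k + 1` (F2b for `D ≤ k+1`; for `D ≥ k+1` both sides are `SI_k` by F2c and G4). -/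
theorem Kr_w_expMul_sum_eq_iInf_of_le {k r : ℕ} (hr : 0 < r) {lam : Fin r → K} (hlam : Function.Injective lam) {P : Fin r → ℕ} {q : Fin r → ℕ → K}
    (hq : ∀ i j, P i < j → q i j = 0) (hqP : ∀ i, q i (P i) ≠ 0) (hkP : ∀ i, k + P i ≤ n) (hDn : ∑ i, (P i + 1) ≤ n + 1 - k) :
    Kr K Finset.univ (w K n n (fun j => ∑ i, expMul K (lam i) (q i) j)) k =
      ⨅ i, (siegelIdeal K n k ⊔ (xRich K n k (P i)).map (Φs K (n := n) (lam i)).toLinearMap) := by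
  rcases le_or_gt (∑ i, (P i + 1)) (k + 1) with h | h
  · exact Kr_w_expMul_sum K hr hlam hq hqP h hDn
  · rw [Kr_w_expMul_sum_eq_siegelIdeal K hlam hq hqP (by omega) hDn, iInf_sup_map_Φs_xRich_eq_siegelIdeal K hlam hkP (by omega)]

/-- the same with the NODE CLASSES' kernels: `Kr(univ, class, k) = ⋂_i Kr(univ, w_n(expMul λ_i q_i), k)` on the whole range `D ≤ n + 1 − k`. -/
theorem Kr_w_expMul_sum_eq_iInf_Kr_of_le {k r : ℕ} (hr : 0 < r) {lam : Fin r → K} (hlam : Function.Injective lam) {P : Fin r → ℕ} {q : Fin r → ℕ → K}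
    (hq : ∀ i j, P i < j → q i j = 0) (hqP : ∀ i, q i (P i) ≠ 0) (hkP : ∀ i, k + P i ≤ n) (hDn : ∑ i, (P i + 1) ≤ n + 1 - k) :
    Kr K Finset.univ (w K n n (fun j => ∑ i, expMul K (lam i) (q i) j)) k = ⨅ i, Kr K Finset.univ (w K n n (expMul K (lam i) (q i))) k := by
  rw [Kr_w_expMul_sum_eq_iInf_of_le K hr hlam hq hqP hkP hDn]
  exact iInf_congr fun i => (Kr_w_expMul_of_order K (lam i) (hkP i) (hq i) (hqP i)).symm

end Summit.Ventures.HSemireg.Wedge.KernelDuality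

namespace Summit.Ventures.HSemireg.Wedge.HankelBoxKernel

open Summit.Ventures.HSemireg.Wedge Summit.Ventures.HSemireg.Wedge.Kunneth Summit.Ventures.HSemireg.Wedge.MixedBox
  Summit.Ventures.HSemireg.Wedge.KunnethKernel Summit.Ventures.HSemireg.Wedge.HankelBox Summit.Ventures.HSemireg.Wedge.HankelSiegelIdeal
  Summit.Ventures.HSemireg.Wedge.HankelFrameChange

variable (K : Type*) [Field K]

section Box

variable {n : ℕ} (m : Fin n → ℕ)

/-! ## §141. Boxes of node classes and of divisor classes -/

/-- **A BOX OF NODE CLASSES, KERNEL NAMED**: factors `v_i` = node classes `w_{m_i}(expMul λ_i q_i)` of exact orders `P_i` with `k + P_i ≤ m_i` (`n ≥ 1`):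
`Kr(univ, F, k) = ⨆_i ⨆_{b ≤ k} emb_i( SI_b ⊔ Φs λ_i (xRich(b, P_i)) ) ∧ Hom(other blocks, k − b)` — C8's flat law with E5's node names. -/
theorem Kr_hankelBox_nodes (hn : 1 ≤ n) (lam : Fin n → K) {P : Fin n → ℕ} {q : Fin n → ℕ → K} (hq : ∀ i j, P i < j → q i j = 0) (hqP : ∀ i, q i (P i) ≠ 0)
    {k : ℕ} (hkP : ∀ i, k + P i ≤ m i) :
    Kr K Finset.univ (hankelBox K m (fun i => expMul K (lam i) (q i))) k =
      ⨆ i : Fin n, ⨆ b ∈ Finset.range (k + 1),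
        (siegelIdeal K (m i) b ⊔ (xRich K (m i) b (P i)).map (Φs K (n := m i) (lam i)).toLinearMap).map (emb K (facEmb m i)).toLinearMap *
          Hom K (Gen m) (oth (blk m) n i) (k - b) := by
  rw [Kr_hankelBox_eq_iSup_T K m hn _ k]
  refine iSup_congr fun i => ?_
  rw [T_hankelBox_eq_map]
  refine iSup_congr fun b => iSup_congr fun hb => ?_
  rw [Kr_w_expMul_of_order K (lam i) (by have := Finset.mem_range.mp hb; have := hkP i; omega) (hq i) (hqP i)]

/-- **A BOX OF DIVISOR CLASSES, KERNEL NAMED**: block `i` carries the divisor class `Σ_j exp(λ_ij Θ_i)·p_ij(Θ_i)` with `r_i > 0` distinct nodes, exact orders `P_ij`, `k + P_ij ≤ m_i` and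
total order `Σ_j (P_ij + 1) ≤ m_i + 1 − k` (`n ≥ 1`):
`Kr(univ, F, k) = ⨆_i ⨆_{b ≤ k} emb_i( ⋂_j (SI_b ⊔ Φs λ_ij (xRich(b, P_ij))) ) ∧ Hom(other blocks, k − b)` — generated by the NODE kernels of the factors (§140 in every block and degree). -/
theorem Kr_hankelBox_divisors (hn : 1 ≤ n) {r : Fin n → ℕ} (hr : ∀ i, 0 < r i) {lam : (i : Fin n) → Fin (r i) → K} (hlam : ∀ i, Function.Injective (lam i))
    {P : (i : Fin n) → Fin (r i) → ℕ} {q : (i : Fin n) → Fin (r i) → ℕ → K} (hq : ∀ i j t, P i j < t → q i j t = 0) (hqP : ∀ i j, q i j (P i j) ≠ 0)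
    {k : ℕ} (hkP : ∀ i j, k + P i j ≤ m i) (hD : ∀ i, ∑ j, (P i j + 1) ≤ m i + 1 - k) :
    Kr K Finset.univ (hankelBox K m (fun i t => ∑ j, expMul K (lam i j) (q i j) t)) k =
      ⨆ i : Fin n, ⨆ b ∈ Finset.range (k + 1),
        (⨅ j, (siegelIdeal K (m i) b ⊔ (xRich K (m i) b (P i j)).map (Φs K (n := m i) (lam i j)).toLinearMap)).map (emb K (facEmb m i)).toLinearMap *
          Hom K (Gen m) (oth (blk m) n i) (k - b) := by
  rw [Kr_hankelBox_eq_iSup_T K m hn _ k]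
  refine iSup_congr fun i => ?_
  rw [T_hankelBox_eq_map]
  refine iSup_congr fun b => iSup_congr fun hb => ?_
  have hbk : b ≤ k := Nat.lt_succ_iff.mp (Finset.mem_range.mp hb)
  rw [KernelDuality.Kr_w_expMul_sum_eq_iInf_of_le K (hr i) (hlam i) (hq i) (hqP i) (fun j => by have := hkP i j; omega) (by have := hD i; omega)]

/-- … equivalently with the node classes' kernels in each block: `⨆_i ⨆_{b ≤ k} emb_i( ⋂_j Kr(univ, w_{m_i}(expMul λ_ij q_ij), b) ) ∧ Hom(other blocks, k − b)`. -/
theorem Kr_hankelBox_divisors' (hn : 1 ≤ n) {r : Fin n → ℕ} (hr : ∀ i, 0 < r i) {lam : (i : Fin n) → Fin (r i) → K} (hlam : ∀ i, Function.Injective (lam i))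
    {P : (i : Fin n) → Fin (r i) → ℕ} {q : (i : Fin n) → Fin (r i) → ℕ → K} (hq : ∀ i j t, P i j < t → q i j t = 0) (hqP : ∀ i j, q i j (P i j) ≠ 0)
    {k : ℕ} (hkP : ∀ i j, k + P i j ≤ m i) (hD : ∀ i, ∑ j, (P i j + 1) ≤ m i + 1 - k) :
    Kr K Finset.univ (hankelBox K m (fun i t => ∑ j, expMul K (lam i j) (q i j) t)) k =
      ⨆ i : Fin n, ⨆ b ∈ Finset.range (k + 1),
        (⨅ j, Kr K Finset.univ (Hankel.w K (m i) (m i) (expMul K (lam i j) (q i j))) b).map (emb K (facEmb m i)).toLinearMap *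
          Hom K (Gen m) (oth (blk m) n i) (k - b) := by
  rw [Kr_hankelBox_eq_iSup_T K m hn _ k]
  refine iSup_congr fun i => ?_
  rw [T_hankelBox_eq_map]
  refine iSup_congr fun b => iSup_congr fun hb => ?_
  have hbk : b ≤ k := Nat.lt_succ_iff.mp (Finset.mem_range.mp hb)
  rw [KernelDuality.Kr_w_expMul_sum_eq_iInf_Kr_of_le K (hr i) (hlam i) (hq i) (hqP i) (fun j => by have := hkP i j; omega) (by have := hD i; omega)]

end Box

end Summit.Ventures.HSemireg.Wedge.HankelBoxKernel
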